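import Summits.QuantumFields.YangMills.Theorems.PencilRigidityWeakCouplingHypercubicLimitDecaySupport
import Summits.QuantumFields.YangMills.Theorems.PencilRigidityWeakCouplingHypercubicLimitSeparatedDensity
import HarnessLib

/-!
# Crux `WeakCouplingHypercubicLimit` (stmt-QuantumFields-16120), line `Sketch`, r10: `stub_decayOfRPSpectral` — RP-spectral clustering
# on the lattice ⇒ exponential decay of the connected OS form of the continuum limit

The registered stub Z3b-D of the skeleton `Cruxes/WeakCouplingHypercubicLimit/Lines/Sketch.lean`.  For a real test function `F` supported at
`δ`-separated points with times in `[τ, ρ]`, the real smeared renormalised functional `Y_k` of `F` (SG-A `curvFunctional_facts`) is fed to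
`RPSpectral r sch Δ C` at the subsequence index `φ k` with `n = 2⌊t/(2a)⌋` lattice time steps, slab height `⌊ρ/a⌋+2`, torus `S = L` and the
polynomial bound `K₁ a^{−Qr n}` (`PolyRenorm`, bounded counterterm, `thermal_bookkeeping`); the three real integrals of the inequality are the
real parts of the complex reflection pairings of `…DecayTransfer` (`fieldObs_translateMulti_eq`, `torusLift_torusConfigShift_proj`,
`conj_fieldObs`), which converge to the continuum quantities (`tendsto_rpPair`, `tendsto_mean`); the thermal term dies by `PolyVolume`; the limit
inequality is `Re conn(F, T_t F) ≤ e^{−Δt} Re conn(F, F)` once `planeSum T n (ΘF*) = conj planeSum T n F` (`planeSum_osAdjoint_eq_conj`) and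
`planeSum T n (T_t F) = planeSum T n F` (`planeSum_translate_eq`) are used (`decay_separated`); general `F` by density
(`separatedDensity_of_isOffDiagonal`) and continuity of the connected OS forms (`stub_decayOfRPSpectral`).

Refs: OsterwalderSeiler1978 §§2–3; GlimmJaffe1987 §6.1, §19.7; OsterwalderSchrader1973 §4.
-/

noncomputable section

open scoped SchwartzMap BigOperators ComplexConjugate
open MeasureTheory Filter Topology
open Literature.MathematicalPhysics.QuantumFieldTheory Literature.MathematicalPhysics.QuantumLattice
open Literature.MathematicalPhysics.AQFT
open Literature.Probability.LatticeModels (box Site)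
open Summit.QuantumFields.YangMills.Cruxes.HypercubicLimit.CouplingResponse
open Summit.QuantumFields.YangMills.Cruxes.OSLegsFromFemtoAndGap.DlrCollarTransfer (plane conn Decay RPPos ConnCS)
open Summit.QuantumFields.YangMills.Cruxes.OSLegsAtWeakCouplingC.Sketch (Separated)
open Summit.QuantumFields.YangMills.Theorems.OSLegsFromFemtoAndGap

namespace Summit.QuantumFields.YangMills.Theorems.WeakCouplingHypercubicLimit.TraceNormColdPressure

variable {G : Type} [Group G] [TopologicalSpace G] [IsTopologicalGroup G] [CompactSpace G]
  [MeasurableSpace G] [BorelSpace G]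

/-! ### The lattice decay inequality and its limit -/

section Main2

variable (r : LatticeRep G) (sch : SpeciesScheme (YMSpecies G)) (φ : ℕ → ℕ) (hφ : StrictMono φ)
  (T : (n : ℕ) → (Fin n → Plane) → (𝓢((Fin n → EuclideanSpace ℝ (Fin 4)), ℂ) →L[ℂ] ℂ))
  (hUFB : UniformFunctionalBoundPlanes r sch) (hPL : PlaneLimits r sch φ T)
  {n : ℕ} {F : 𝓢((Fin n → EuclideanSpace ℝ (Fin 4)), ℂ)} {ρ τ δ : ℝ} (hτ : 0 < τ) (hδ : 0 < δ) (hρ : 0 ≤ ρ)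
  (hFρ : tsupport (F : (Fin n → EuclideanSpace ℝ (Fin 4)) → ℂ) ⊆ Metric.closedBall 0 ρ)
  (hFτ : tsupport (F : (Fin n → EuclideanSpace ℝ (Fin 4)) → ℂ) ⊆ {u | ∀ l, τ ≤ u l 0})
  (hFδ : tsupport (F : (Fin n → EuclideanSpace ℝ (Fin 4)) → ℂ) ⊆ Separated n δ)
  (hFr : ∀ u, conj (F u) = F u)

include hφ hUFB hPL hτ hδ hρ hFρ hFτ hFδ hFr

/-- **The decay inequality on the separated class.**  From RP-spectral clustering along the scheme, polynomial volume growth and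
renormalisation and a bounded counterterm: for a real test function supported at `δ`-separated points with times in
`[τ, ρ]` and every `t ≥ 0`, `Re conn(F, T_t F) ≤ Re conn(F, F) · e^{−Δt}` for the candidate family `planeSum T`. [folklore] -/
theorem decay_separated (hpv : PolyVolume sch) (hpr : PolyRenorm r sch) (hbm : ∃ Cm : ℝ, ∀ k, |sch.m r.curvature k| ≤ Cm)
    {Δ C : ℝ} (hΔ : 0 < Δ) (hrp : RPSpectral r sch Δ C) {t : ℝ} (ht : 0 ≤ t) :
    (conn (planeSum T) F (translateMulti (EuclideanSpace.single (0 : Fin 4) t) F)).re ≤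
      (conn (planeSum T) F F).re * Real.exp (-(Δ * t)) := by
  classical
  obtain ⟨Cp, hCp0, hfacts⟩ := curvFunctional_facts G r
  obtain ⟨Cm, hCm⟩ := hbm
  obtain ⟨Qr, hQr⟩ := hpr
  have hCm0 : 0 ≤ Cm := (abs_nonneg _).trans (hCm 0)
  have hFps := posSep_of_separated hδ hτ hFδ hFτ
  have hFo : IsOffDiagonal F := isOffDiagonal_of_posSep hFps
  -- lattice times and translation vectors
  have ha0 : Tendsto (fun k => sch.a (φ k)) atTop (𝓝 0) := sch.tendsto_a.comp hφ.tendsto_atTop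
  have haL : Tendsto (fun k => sch.a (φ k) * sch.L (φ k)) atTop atTop := sch.tendsto_L.comp hφ.tendsto_atTop
  obtain ⟨hjb, hcoef⟩ := latticeTime_facts ht (fun k => sch.a_pos (φ k)) ha0
  set jj : ℕ → ℕ := fun k => ⌊t / (2 * sch.a (φ k))⌋₊ with hjj
  set vv : ℕ → EuclideanSpace ℝ (Fin 4) := fun k =>
    ((((2 * jj k : ℕ) : ℝ) * sch.a (φ k)) • EuclideanSpace.single (0 : Fin 4) (1 : ℝ)) with hvv
  have hvv_lim : Tendsto vv atTop (𝓝 (EuclideanSpace.single (0 : Fin 4) t)) := by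
    have h := hcoef.smul_const (EuclideanSpace.single (0 : Fin 4) (1 : ℝ))
    rwa [smul_single_one_eq] at h
  have hvv0 : ∀ k, 0 ≤ vv k 0 := fun k => by
    have h1 : vv k 0 = ((2 * jj k : ℕ) : ℝ) * sch.a (φ k) := by simp [hvv]
    rw [h1]; exact mul_nonneg (Nat.cast_nonneg _) (sch.a_pos (φ k)).le
  -- the renormalised test functions are real
  have hFkr : ∀ k x, conj (((((sch.c r.curvature (φ k) * sch.a (φ k) ^ 4) ^ n : ℝ) : ℂ) • F) x) =
      ((((sch.c r.curvature (φ k) * sch.a (φ k) ^ 4) ^ n : ℝ) : ℂ) • F) x := fun k x => by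
    show conj ((_ : ℂ) • F x) = (_ : ℂ) • F x
    rw [smul_eq_mul, map_mul, Complex.conj_ofReal, hFr x]
  -- the three continuum quantities as limits of lattice pairings (toolkit A)
  have hP2 := tendsto_rpPair r sch φ hφ T hUFB hPL hτ hδ hFρ hFτ hFδ F hFps vv _ hvv_lim hvv0
  have hP0 := tendsto_rpPair r sch φ hφ T hUFB hPL hτ hδ hFρ hFτ hFδ F hFps (fun _ => 0) 0 tendsto_const_nhds
    (fun _ => le_rfl)
  simp only [translateMulti_zero_eq] at hP0
  have hP1 := tendsto_mean r sch φ T hPL hτ hδ hFτ hFδ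
  -- identities of the limit family on this class
  have hherm := planeSum_osAdjoint_eq_conj r sch φ hφ T hUFB hPL hτ hδ hFρ hFτ hFδ
  have hreal := conj_planeSum_eq r sch φ T hPL hτ hδ hFτ hFδ hFr
  have htrans := planeSum_translate_eq r sch φ hφ T hUFB hPL hτ hδ hρ hFρ hFτ hFδ ht
  -- the real lattice functional `Y k` and its facts (toolkit SG-A)
  obtain ⟨Y, hY⟩ : ∃ Y : ℕ → LGConfig 4 G → ℝ, Y = fun k V =>
      (∑ q ∈ Fintype.piFinset (fun _ : Fin n => Finset.univ.filter fun p : Fin 4 × Fin 4 => p.1 < p.2),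
        ∑ y ∈ Fintype.piFinset (fun _ : Fin n => box 4 (sch.L (φ k))),
          ((((sch.c r.curvature (φ k) * sch.a (φ k) ^ 4) ^ n : ℝ) : ℂ) • F) (fun l => sch.a (φ k) • siteToE (y l)) *
            ((∏ l, (plane G r (q l) (y l) V - sch.m r.curvature (φ k) / 6) : ℝ) : ℂ)).re := ⟨_, rfl⟩
  have hm6 : ∀ k, ∀ q : Fin 4 × Fin 4, |(fun _ : Fin 4 × Fin 4 => sch.m r.curvature (φ k) / 6) q| ≤ Cm / 6 := by
    intro k q
    show |sch.m r.curvature (φ k) / 6| ≤ Cm / 6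
    rw [abs_div, abs_of_pos (by norm_num : (0:ℝ) < 6)]
    exact div_le_div_of_nonneg_right (hCm _) (by norm_num)
  have hYm : ∀ k, Measurable (Y k) := fun k => by
    rw [hY]; exact (hfacts (sch.L (φ k)) (sch.a (φ k)) n _ _ _ (hm6 k)).1
  have hYb : ∀ k V, |Y k V| ≤ (6 * (Cp + Cm / 6)) ^ n *
      ∑ y ∈ Fintype.piFinset (fun _ : Fin n => box 4 (sch.L (φ k))),
        ‖((((sch.c r.curvature (φ k) * sch.a (φ k) ^ 4) ^ n : ℝ) : ℂ) • F) (fun l => sch.a (φ k) • siteToE (y l))‖ :=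
    fun k V => by rw [hY]; exact (hfacts (sch.L (φ k)) (sch.a (φ k)) n _ _ _ (hm6 k)).2.1 V
  have hYd : ∀ k, DependsOn (Y k) {e : Literature.MathematicalPhysics.QuantumLattice.ZdEdge 4 |
      1 ≤ e.1 0 ∧ e.1 0 + (if e.2 = 0 then 1 else 0) ≤ ((⌊ρ / sch.a (φ k)⌋₊ + 2 : ℕ) : ℤ)} := fun k => by
    rw [hY]
    exact (hfacts (sch.L (φ k)) (sch.a (φ k)) n _ _ _ (hm6 k)).2.2 _ (slab_support r sch φ hτ hFρ hFτ k)
  -- the smeared field is the real functional read through the lift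
  have hYf : ∀ k (U : GaugeConfig 4 (2 * sch.L (φ k) + 1) G),
      fieldObs r (sch.L (φ k)) (sch.a (φ k)) ((((sch.c r.curvature (φ k) * sch.a (φ k) ^ 4) ^ n : ℝ) : ℂ) • F)
        (fun _ => sch.m r.curvature (φ k) / 6) U = ((Y k (torusLift (2 * sch.L (φ k) + 1) U) : ℝ) : ℂ) := by
    intro k U
    have hre := Complex.conj_eq_iff_re.1 (conj_fieldObs r (sch.L (φ k)) (sch.a (φ k)) _
      (fun _ => sch.m r.curvature (φ k) / 6) (hFkr k) U)
    rw [← hre, hY]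
    rfl
  -- an explicit polynomial bound of the functional
  set K₁ : ℝ := (6 * (Cp + Cm / 6)) ^ n * ((2 * ρ + 3) ^ (4 * n) * SchwartzMap.seminorm ℂ 0 0 F) with hK₁
  have hK₁0 : 0 ≤ K₁ := by positivity
  have hYB : ∀ k, sch.a (φ k) ≤ 1 → ∀ V, |Y k V| ≤ K₁ * ((sch.a (φ k))⁻¹ ^ Qr) ^ n := by
    intro k hak V
    have ha := sch.a_pos (φ k)
    refine (hYb k V).trans ?_
    have hsupp : tsupport (((((sch.c r.curvature (φ k) * sch.a (φ k) ^ 4) ^ n : ℝ) : ℂ) • F :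
        𝓢((Fin n → EuclideanSpace ℝ (Fin 4)), ℂ)) : (Fin n → EuclideanSpace ℝ (Fin 4)) → ℂ) ⊆ Metric.closedBall 0 ρ := by
      have hfun : (((((sch.c r.curvature (φ k) * sch.a (φ k) ^ 4) ^ n : ℝ) : ℂ) • F :
          𝓢((Fin n → EuclideanSpace ℝ (Fin 4)), ℂ)) : (Fin n → EuclideanSpace ℝ (Fin 4)) → ℂ) =
          fun u => ((((sch.c r.curvature (φ k) * sch.a (φ k) ^ 4) ^ n : ℝ) : ℂ)) * F u := rfl
      rw [hfun]
      exact (tsupport_mul_subset_right (f := fun _ => ((((sch.c r.curvature (φ k) * sch.a (φ k) ^ 4) ^ n : ℝ) : ℂ)))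
        (g := (F : (Fin n → EuclideanSpace ℝ (Fin 4)) → ℂ))).trans hFρ
    have hsum := thermal_bookkeeping_sum_le n _ ρ (sch.a (φ k)) (sch.L (φ k)) ha hρ hsupp
    rw [map_smul_eq_mul, Complex.norm_real, Real.norm_eq_abs, abs_pow, abs_mul, abs_pow,
      abs_of_pos ha] at hsum
    refine (mul_le_mul_of_nonneg_left hsum (by positivity)).trans ?_
    -- `(2ρ/a+3)^{4n} a^{4n} = (2ρ+3a)^{4n} ≤ (2ρ+3)^{4n}` and `|c|^n ≤ a^{-Qr n}`
    have h1 : (2 * ρ / sch.a (φ k) + 3) ^ (4 * n) * (sch.a (φ k) ^ 4) ^ n ≤ (2 * ρ + 3) ^ (4 * n) := by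
      rw [show (sch.a (φ k) ^ 4) ^ n = sch.a (φ k) ^ (4 * n) by ring, ← mul_pow]
      apply pow_le_pow_left₀ (by positivity)
      rw [add_mul, div_mul_cancel₀ _ ha.ne']
      nlinarith
    have h2 : |sch.c r.curvature (φ k)| ^ n ≤ ((sch.a (φ k))⁻¹ ^ Qr) ^ n :=
      pow_le_pow_left₀ (abs_nonneg _) (hQr _) n
    have h3 : 0 ≤ SchwartzMap.seminorm ℂ 0 0 F := apply_nonneg _ _
    calc (6 * (Cp + Cm / 6)) ^ n * ((2 * ρ / sch.a (φ k) + 3) ^ (4 * n) *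
          ((|sch.c r.curvature (φ k)| * sch.a (φ k) ^ 4) ^ n * SchwartzMap.seminorm ℂ 0 0 F))
        = (6 * (Cp + Cm / 6)) ^ n * (((2 * ρ / sch.a (φ k) + 3) ^ (4 * n) * (sch.a (φ k) ^ 4) ^ n) *
            SchwartzMap.seminorm ℂ 0 0 F * |sch.c r.curvature (φ k)| ^ n) := by ring
      _ ≤ (6 * (Cp + Cm / 6)) ^ n * ((2 * ρ + 3) ^ (4 * n) * SchwartzMap.seminorm ℂ 0 0 F *
            ((sch.a (φ k))⁻¹ ^ Qr) ^ n) := by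
          apply mul_le_mul_of_nonneg_left _ (by positivity)
          exact mul_le_mul (mul_le_mul_of_nonneg_right h1 h3) h2 (by positivity) (by positivity)
      _ = K₁ * ((sch.a (φ k))⁻¹ ^ Qr) ^ n := by rw [hK₁]; ring
  -- eventual geometric conditions
  have ha1 : ∀ᶠ k in atTop, sch.a (φ k) ≤ 1 := (ha0.eventually (ge_mem_nhds one_pos))
  have hgeom : ∀ᶠ k in atTop, 2 * ((⌊ρ / sch.a (φ k)⌋₊ + 2) + 2 * jj k + 1) ≤ sch.L (φ k) := by
    filter_upwards [haL.eventually (eventually_ge_atTop (2 * ρ + 2 * t + 6)), ha1] with k hk hak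
    have ha := sch.a_pos (φ k)
    have hfl : ((⌊ρ / sch.a (φ k)⌋₊ : ℕ) : ℝ) ≤ ρ / sch.a (φ k) := Nat.floor_le (by positivity)
    have hj : ((2 * jj k : ℕ) : ℝ) * sch.a (φ k) ≤ t := (hjb k).2
    have h1 : (⌊ρ / sch.a (φ k)⌋₊ : ℝ) * sch.a (φ k) ≤ ρ := by
      have := mul_le_mul_of_nonneg_right hfl ha.le
      rwa [div_mul_cancel₀ _ ha.ne'] at this
    have h2 : (jj k : ℝ) * sch.a (φ k) * 2 ≤ t := by push_cast at hj; linarith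
    have hreal : ((2 * ((⌊ρ / sch.a (φ k)⌋₊ + 2) + 2 * jj k + 1) : ℕ) : ℝ) * sch.a (φ k) ≤ (sch.L (φ k) : ℝ) * sch.a (φ k) := by
      push_cast
      nlinarith [h1, h2, hk, hak, ha.le]
    have h := le_of_mul_le_mul_right hreal ha
    exact_mod_cast h
  have hbox := box_margin r sch φ hφ hρ hFρ ht
  have hrpφ := hφ.tendsto_atTop.eventually hrp
  -- the lattice inequality, eventually, in terms of the complex pairings
  have hineq : ∀ᶠ k in atTop,
      (∫ U, conj (fieldObs r (sch.L (φ k)) (sch.a (φ k))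
            ((((sch.c r.curvature (φ k) * sch.a (φ k) ^ 4) ^ n : ℝ) : ℂ) • F) (fun _ => sch.m r.curvature (φ k) / 6)
            (GaugeConfig.timeReflect U)) *
          fieldObs r (sch.L (φ k)) (sch.a (φ k))
            ((((sch.c r.curvature (φ k) * sch.a (φ k) ^ 4) ^ n : ℝ) : ℂ) • translateMulti (vv k) F)
            (fun _ => sch.m r.curvature (φ k) / 6) U
        ∂(wilsonMeasure r.ρ (sch.β (φ k)) : Measure (GaugeConfig 4 (2 * sch.L (φ k) + 1) G))).re -
        (∫ U, fieldObs r (sch.L (φ k)) (sch.a (φ k))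
          ((((sch.c r.curvature (φ k) * sch.a (φ k) ^ 4) ^ n : ℝ) : ℂ) • F) (fun _ => sch.m r.curvature (φ k) / 6) U
          ∂(wilsonMeasure r.ρ (sch.β (φ k)) : Measure (GaugeConfig 4 (2 * sch.L (φ k) + 1) G))).re ^ 2 ≤
      Real.exp (-(Δ * sch.a (φ k) * ((2 * jj k : ℕ) : ℝ))) *
        ((∫ U, conj (fieldObs r (sch.L (φ k)) (sch.a (φ k))
            ((((sch.c r.curvature (φ k) * sch.a (φ k) ^ 4) ^ n : ℝ) : ℂ) • F) (fun _ => sch.m r.curvature (φ k) / 6)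
            (GaugeConfig.timeReflect U)) *
          fieldObs r (sch.L (φ k)) (sch.a (φ k))
            ((((sch.c r.curvature (φ k) * sch.a (φ k) ^ 4) ^ n : ℝ) : ℂ) • F)
            (fun _ => sch.m r.curvature (φ k) / 6) U
          ∂(wilsonMeasure r.ρ (sch.β (φ k)) : Measure (GaugeConfig 4 (2 * sch.L (φ k) + 1) G))).re -
        (∫ U, fieldObs r (sch.L (φ k)) (sch.a (φ k))
          ((((sch.c r.curvature (φ k) * sch.a (φ k) ^ 4) ^ n : ℝ) : ℂ) • F) (fun _ => sch.m r.curvature (φ k) / 6) U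
          ∂(wilsonMeasure r.ρ (sch.β (φ k)) : Measure (GaugeConfig 4 (2 * sch.L (φ k) + 1) G))).re ^ 2) +
      C * (K₁ * ((sch.a (φ k))⁻¹ ^ Qr) ^ n) ^ 2 * Real.exp (-(Δ * sch.a (φ k) * (sch.L (φ k) : ℝ))) := by
    filter_upwards [hrpφ, hgeom, hbox, ha1] with k hrpk hgk hbk hak
    have habs := hrpk (sch.L (φ k)) (⌊ρ / sch.a (φ k)⌋₊ + 2) (2 * jj k) le_rfl hgk (Y k)
      (K₁ * ((sch.a (φ k))⁻¹ ^ Qr) ^ n) (hYm k) (hYB k hak) (hYd k)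
    -- the three real integrals are the real parts of the complex pairings
    have e1 : ∀ U : GaugeConfig 4 (2 * sch.L (φ k) + 1) G, ((Y k (torusLift (2 * sch.L (φ k) + 1) U) : ℝ) : ℂ) =
        fieldObs r (sch.L (φ k)) (sch.a (φ k)) ((((sch.c r.curvature (φ k) * sch.a (φ k) ^ 4) ^ n : ℝ) : ℂ) • F)
          (fun _ => sch.m r.curvature (φ k) / 6) U := fun U => (hYf k U).symm
    have e2 : ∀ U : GaugeConfig 4 (2 * sch.L (φ k) + 1) G,
        ((Y k (configShift (-Pi.single 0 ((2 * jj k : ℕ) : ℤ)) (torusLift (2 * sch.L (φ k) + 1) U)) : ℝ) : ℂ) =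
        fieldObs r (sch.L (φ k)) (sch.a (φ k))
          ((((sch.c r.curvature (φ k) * sch.a (φ k) ^ 4) ^ n : ℝ) : ℂ) • translateMulti (vv k) F)
          (fun _ => sch.m r.curvature (φ k) / 6) U := by
      intro U
      rw [← torusLift_torusConfigShift_proj, e1, ← map_smul]
      exact (fieldObs_translateMulti_eq r (sch.L (φ k)) (sch.a (φ k)) (2 * jj k) _ _ hbk U).symm
    have hconj : ∀ U : GaugeConfig 4 (2 * sch.L (φ k) + 1) G,
        conj (fieldObs r (sch.L (φ k)) (sch.a (φ k)) ((((sch.c r.curvature (φ k) * sch.a (φ k) ^ 4) ^ n : ℝ) : ℂ) • F)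
          (fun _ => sch.m r.curvature (φ k) / 6) U) =
        fieldObs r (sch.L (φ k)) (sch.a (φ k)) ((((sch.c r.curvature (φ k) * sch.a (φ k) ^ 4) ^ n : ℝ) : ℂ) • F)
          (fun _ => sch.m r.curvature (φ k) / 6) U := fun U => conj_fieldObs r _ _ _ _ (hFkr k) U
    have hE2 : (∫ U, conj (fieldObs r (sch.L (φ k)) (sch.a (φ k))
            ((((sch.c r.curvature (φ k) * sch.a (φ k) ^ 4) ^ n : ℝ) : ℂ) • F) (fun _ => sch.m r.curvature (φ k) / 6)
            (GaugeConfig.timeReflect U)) *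
          fieldObs r (sch.L (φ k)) (sch.a (φ k))
            ((((sch.c r.curvature (φ k) * sch.a (φ k) ^ 4) ^ n : ℝ) : ℂ) • translateMulti (vv k) F)
            (fun _ => sch.m r.curvature (φ k) / 6) U
        ∂(wilsonMeasure r.ρ (sch.β (φ k)) : Measure (GaugeConfig 4 (2 * sch.L (φ k) + 1) G))).re =
        ∫ U, Y k (torusLift (2 * sch.L (φ k) + 1) (GaugeConfig.timeReflect U)) *
          Y k (configShift (-Pi.single 0 ((2 * jj k : ℕ) : ℤ)) (torusLift (2 * sch.L (φ k) + 1) U))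
        ∂(wilsonMeasure r.ρ (sch.β (φ k)) : Measure (GaugeConfig 4 (2 * sch.L (φ k) + 1) G)) := by
      rw [← Complex.ofReal_re (∫ U, Y k (torusLift (2 * sch.L (φ k) + 1) (GaugeConfig.timeReflect U)) *
          Y k (configShift (-Pi.single 0 ((2 * jj k : ℕ) : ℤ)) (torusLift (2 * sch.L (φ k) + 1) U))
        ∂(wilsonMeasure r.ρ (sch.β (φ k)) : Measure (GaugeConfig 4 (2 * sch.L (φ k) + 1) G))), ← integral_complex_ofReal]
      congr 1
      refine integral_congr_ae (ae_of_all _ fun U => ?_)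
      dsimp only
      rw [hconj, Complex.ofReal_mul, e1, e2]
    have hE0 : (∫ U, conj (fieldObs r (sch.L (φ k)) (sch.a (φ k))
            ((((sch.c r.curvature (φ k) * sch.a (φ k) ^ 4) ^ n : ℝ) : ℂ) • F) (fun _ => sch.m r.curvature (φ k) / 6)
            (GaugeConfig.timeReflect U)) *
          fieldObs r (sch.L (φ k)) (sch.a (φ k))
            ((((sch.c r.curvature (φ k) * sch.a (φ k) ^ 4) ^ n : ℝ) : ℂ) • F)
            (fun _ => sch.m r.curvature (φ k) / 6) U
          ∂(wilsonMeasure r.ρ (sch.β (φ k)) : Measure (GaugeConfig 4 (2 * sch.L (φ k) + 1) G))).re =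
        ∫ U, Y k (torusLift (2 * sch.L (φ k) + 1) (GaugeConfig.timeReflect U)) * Y k (torusLift (2 * sch.L (φ k) + 1) U)
        ∂(wilsonMeasure r.ρ (sch.β (φ k)) : Measure (GaugeConfig 4 (2 * sch.L (φ k) + 1) G)) := by
      rw [← Complex.ofReal_re (∫ U, Y k (torusLift (2 * sch.L (φ k) + 1) (GaugeConfig.timeReflect U)) *
          Y k (torusLift (2 * sch.L (φ k) + 1) U)
        ∂(wilsonMeasure r.ρ (sch.β (φ k)) : Measure (GaugeConfig 4 (2 * sch.L (φ k) + 1) G))), ← integral_complex_ofReal]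
      congr 1
      refine integral_congr_ae (ae_of_all _ fun U => ?_)
      dsimp only
      rw [hconj, Complex.ofReal_mul, e1, e1]
    have hE1 : (∫ U, fieldObs r (sch.L (φ k)) (sch.a (φ k))
          ((((sch.c r.curvature (φ k) * sch.a (φ k) ^ 4) ^ n : ℝ) : ℂ) • F) (fun _ => sch.m r.curvature (φ k) / 6) U
          ∂(wilsonMeasure r.ρ (sch.β (φ k)) : Measure (GaugeConfig 4 (2 * sch.L (φ k) + 1) G))).re =
        ∫ U, Y k (torusLift (2 * sch.L (φ k) + 1) U)
        ∂(wilsonMeasure r.ρ (sch.β (φ k)) : Measure (GaugeConfig 4 (2 * sch.L (φ k) + 1) G)) := by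
      rw [← Complex.ofReal_re (∫ U, Y k (torusLift (2 * sch.L (φ k) + 1) U)
        ∂(wilsonMeasure r.ρ (sch.β (φ k)) : Measure (GaugeConfig 4 (2 * sch.L (φ k) + 1) G))), ← integral_complex_ofReal]
      congr 1
      refine integral_congr_ae (ae_of_all _ fun U => ?_)
      dsimp only
      rw [e1]
    rw [hE2, hE0, hE1]
    have h := (le_abs_self _).trans habs
    linarith
  -- limits of the two sides of the lattice inequality
  have hA2 := (Complex.continuous_re.tendsto _).comp hP2
  have hA0 := (Complex.continuous_re.tendsto _).comp hP0
  have hA1 := (Complex.continuous_re.tendsto _).comp hP1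
  have hE : Tendsto (fun k => Real.exp (-(Δ * sch.a (φ k) * ((2 * jj k : ℕ) : ℝ)))) atTop (𝓝 (Real.exp (-(Δ * t)))) := by
    have h1 : Tendsto (fun k => -(Δ * (((2 * jj k : ℕ) : ℝ) * sch.a (φ k)))) atTop (𝓝 (-(Δ * t))) :=
      (hcoef.const_mul Δ).neg
    refine ((Real.continuous_exp.tendsto _).comp h1).congr fun k => ?_
    simp only [Function.comp_apply]
    ring_nf
  have hTh : Tendsto (fun k => C * (K₁ * ((sch.a (φ k))⁻¹ ^ Qr) ^ n) ^ 2 *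
      Real.exp (-(Δ * sch.a (φ k) * (sch.L (φ k) : ℝ)))) atTop (𝓝 0) := by
    have h := (thermal_bookkeeping_tendsto sch hpv Δ hΔ (2 * (Qr * n)) 0 (C * K₁ ^ 2)).comp hφ.tendsto_atTop
    refine h.congr fun k => ?_
    simp only [Function.comp_apply, pow_zero, mul_one]
    ring
  have hlim := le_of_tendsto_of_tendsto (hA2.sub (hA1.pow 2)) ((hE.mul (hA0.sub (hA1.pow 2))).add hTh) hineq
  simp only [add_zero] at hlim
  -- the connected OS forms of the limit family
  have hσ : planeSum T n F = (((planeSum T n F).re : ℝ) : ℂ) := (Complex.conj_eq_iff_re.1 hreal).symm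
  have hcs : (conj (planeSum T n F) * planeSum T n F).re = (planeSum T n F).re ^ 2 := by
    rw [hreal]
    conv_lhs => rw [hσ]
    rw [← Complex.ofReal_mul, Complex.ofReal_re]
    ring
  simp only [conn]
  rw [hherm, htrans, Complex.sub_re, Complex.sub_re, hcs]
  nlinarith [hlim, Real.exp_pos (-(Δ * t))]

end Main2

/-- `stub_decayOfRPSpectral` (Z3b-D, line `Sketch`, r10b; registered) — **RP-spectral relative clustering on the lattice ⇒ exponential
decay of the diagonal connected OS form of the limit** (`Decay (planeSum T) Δ`): by `decay_separated` on the dense class of real test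
functions compactly supported at separated positive-time points (`separatedDensity_of_isOffDiagonal`, `exists_time_floor`,
`exists_radius`), and continuity of the connected OS forms in the test function (`continuous_conn_translateMulti`,
`continuous_conn_self`). [folklore] -/
theorem stub_decayOfRPSpectral :
    ∀ (G : Type) [Group G] [TopologicalSpace G] [IsTopologicalGroup G] [CompactSpace G]
      [MeasurableSpace G] [BorelSpace G] (r : LatticeRep G) (sch : SpeciesScheme (YMSpecies G))
      (φ : ℕ → ℕ) (hφ : StrictMono φ)
      (T : (n : ℕ) → (Fin n → Plane) → (𝓢((Fin n → EuclideanSpace ℝ (Fin 4)), ℂ) →L[ℂ] ℂ)) (Δ C : ℝ),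
      0 < Δ → PolyVolume sch → PolyRenorm r sch → (∃ Cm : ℝ, ∀ k, |sch.m r.curvature k| ≤ Cm) →
        UniformFunctionalBoundPlanes r sch → PlaneLimits r sch φ T → RPSpectral r sch Δ C → Decay (planeSum T) Δ := by
  intro G _ _ _ _ _ _ r sch φ hφ T Δ C hΔ hpv hpr hbm hUFB hPL hrp n F hFo hFp hFc hFr t ht
  obtain ⟨u, hu_c, hu_sep, hu_supp, hu_real, hu_lim⟩ := separatedDensity_of_isOffDiagonal n F hFo
  have hreal := hu_real hFr
  -- each approximant satisfies the inequality
  have hkey : ∀ m, (conn (planeSum T) (u m) (translateMulti (EuclideanSpace.single (0 : Fin 4) t) (u m))).re ≤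
      (conn (planeSum T) (u m) (u m)).re * Real.exp (-(Δ * t)) := by
    intro m
    obtain ⟨δ, hδ, hsep⟩ := hu_sep m
    have hpos : tsupport (u m : (Fin n → EuclideanSpace ℝ (Fin 4)) → ℂ) ⊆ {v | ∀ l, 0 < v l 0} :=
      fun v hv => hFp (hu_supp m hv)
    obtain ⟨τ, hτ, hFτ⟩ := exists_time_floor (hu_c m) hpos
    obtain ⟨ρ, hρ, hFρ⟩ := exists_radius (hu_c m)
    exact decay_separated r sch φ hφ T hUFB hPL hτ hδ hρ hFρ hFτ hsep (hreal m) hpv hpr hbm hΔ hrp ht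
  -- pass to the limit along the approximants
  have h1 := ((continuous_conn_translateMulti (planeSum T) n (EuclideanSpace.single (0 : Fin 4) t)).tendsto F).comp hu_lim
  have h2 := ((continuous_conn_self (planeSum T) n).tendsto F).comp hu_lim
  exact le_of_tendsto_of_tendsto ((Complex.continuous_re.tendsto _).comp h1)
    (((Complex.continuous_re.tendsto _).comp h2).mul_const _) (Eventually.of_forall hkey)


end Summit.QuantumFields.YangMills.Theorems.WeakCouplingHypercubicLimit.TraceNormColdPressure

end
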